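import Summits.AtomisticToContinuum.Crystallization.Theorems.ChargedEnergyGapChartDialH

/-!
# `ChargedEnergyGap` · the CHART DIAL, part I: CLEAN BALLS — decomp-a2c lens-3 g38 node «ScaleCoherence», the residual re-typed

Part H reduced UPGRADE (`UpgradeWitness θ R M R'`, part D §4) to a NO-ZOOM hypothesis along chains of charted shell hops
(`ChainHarnack θ (2R) M₀`, resp. the ball-anywhere form `ChainHarnackIn θ R M₀`) plus the dictionary.  The g38 zoom census then
showed that CHAIN no-zoom is a knife-edge at the dials `(θ, R) = (3/20, 3)`: a LOXODROMIC layered cluster (layer `j+1 = S(layer j)`,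
`S = λ·R_ω + t`, `λ = 0.8895`, `ω = 7.43°` about an axis orthogonal to the hop) carries a `3/20`-charted infinite zooming chain of
excursion `6.6` start-scales (minimal enclosing ball radius `3.30`), so `ChainHarnack (3/20) (33/5) ·` and `ChainHarnackIn (3/20) (33/10) ·`
are FALSE.  That cluster is no threat to UPGRADE itself: every one of its layer patches ends in UNCHARTED CHARGED (gross) sites OF
THE SAME SCALE as the chain passing it — comparable gross witnesses are everywhere.  The chain hypotheses of part H are blind to them.

§1 THE RESIDUAL RE-TYPED: `CleanBallHarnack θ R M₀ M₁` — chain no-zoom is only asked in CLEAN balls: balls `B̄(c, D) ∋ x`,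
   `D ≤ R·nn x`, in which every uncharted site of scale `≥ nn x / M₁` is charge-free (no COMPARABLE gross site).  It is implied by
   `ChainHarnackIn θ R M₀` (drop the cleanness hypothesis) and is IMMUNE to gross-bounded zooms by design: the loxodromic and the
   truncated-inversion clusters violate cleanness in every ball their chains zoom in (layer-patch rims, resp. the fan-axis crowding,
   at the top scales).  What can still kill it is a CLEAN charted zoom — a `θ`-charted (or charge-free) cluster filling the ball at all
   scales `≥ nn x/M₁` while a chain inside zooms by `> M₀`: by Liouville's theorem the smooth clean zooms are Möbius, with zoom
   `≤ (N(θ)/(N(θ) − 2R))²` inside the ball (`N(3/20) = 15`: `2.78` at `R = 3`, `1.86` at `R = 2`), times a quasiconformal stretch factor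
   (radial power maps `x|x|^{α−1}` are `3/20`-charted only for `|1 − α| ≲ 0.13`, zoom `≤ 6^{0.13} ≈ 1.3` across the ball).  TRUE-type
   expected with margin at BOTH dials `R = 2` and `R = 3` (`M₀ := 4`); the statement to prove is quantitative discrete Liouville /
   quasiconformal stability for FULLY clean charted regions (Reshetnyak, Faraco–Zhong 2005) — the standard setting, not the chain setting.
§2 THE ASSEMBLY (proved, `θ ≤ 3/20`): `upgradeWitness_of_cleanBallHarnack` —
   `CleanBallHarnack θ R M₀ M₁ ∧ ChargeFreeCharted θ ⟹ UpgradeWitness θ R (max M₁ (20·M₀)) (2R)`: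
   either the core-centred ball `B̄(z, dist x z)` contains a comparable gross site (it IS the witness, ratio `M₁`, distance `≤ 2R·nn x`),
   or the ball is clean and part H's extremal charted-chain argument runs verbatim (ratio `20·M₀`).  Hence
   `FarFieldPricing θ R ∧ CleanBallHarnack θ R M₀ M₁ ∧ ChargeFreeCharted θ ⟹ ChartedChargePricing θ`
   (`chartedChargePricing_of_far_cleanBallHarnack`); literal of record at `(3/20, R, M₀ := 4, M₁ := 80)`:
   `UpgradeWitness (3/20) R 80 (2R)` for `R = 2` or `R = 3` — the `R`-dial is returned to FAR's convenience.
-/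

noncomputable section

open Literature.MathematicalPhysics.StatisticalMechanics
open Literature.Geometry.DiscreteGeometry
open Summit.AtomisticToContinuum.Crystallization.Theses.PricedLinkCensus
open Summit.AtomisticToContinuum.Crystallization.Theorems.ChargedEnergyGapNegative
namespace Summit.AtomisticToContinuum.Crystallization.Theorems.ChargedEnergyGapChartDial

/-! ## §1 Clean-ball chain Harnack -/

/-- piece NOZOOM-CLEAN · residual of UPGRADE, re-typed after the g38 zoom census · GEOMETRIC (no energy) · WEAKER than
`ChainHarnackIn θ R M₀` (`cleanBallHarnack_of_chainHarnackIn`) · immune to gross-bounded zooms (loxodromic layered clusters,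
truncated inversions) by its cleanness hypothesis · QUANTITATIVE: needs `M₀ ≥ (15/(15 − 2R))²` (inverted fcc/hcp, `N(3/20) = 15`:
`2.78` at `R = 3`, `1.86` at `R = 2`) · TRUE-type expected at `(3/20, 3, 4, 80)` and `(3/20, 2, 4, 80)` · IDEA-NEEDED (quantitative
discrete Liouville / quasiconformal stability of fully clean `θ`-charted regions) · INSTRUMENTABLE (census I-ZOOM(c): maximal zoom
of CLEAN `3/20`-charted clusters inside `2R` start-scales; Möbius ∘ radial-stretch is the conjectured extremal).  Why it might fail:
a clean non-Möbius charted zoom — a `3/20`-charted cluster without comparable uncharted charged sites whose scale still drops by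
`> M₀` inside the ball (quasiconformal with dilatation `≈ 1.35` leaves room beyond Möbius).
**Clean-ball chain Harnack**: if `x` is charted, `x ∈ B̄(c, D)`, `D ≤ R·nn x`, and every uncharted site `q ∈ B̄(c, D)` with
`nn x ≤ M₁·nn q` is charge-free, then along every chain of charted shell hops from `x` inside `B̄(c, D)` the scale stays `≥ nn x / M₀`. -/
def CleanBallHarnack (θ R M₀ M₁ : ℝ) : Prop :=
  ∀ (Q : PeriodicConfiguration 3) (x p : Q.points) (c : E3) (D : ℝ), ChartedAt θ Q x →
    dist (x : E3) c ≤ D → D ≤ R * nn Q x →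
    (∀ q : Q.points, dist (q : E3) c ≤ D → nn Q x ≤ M₁ * nn Q q → ¬ ChartedAt θ Q q →
      IsChargeFree (1 / 100) (Subtype.val : Q.points → E3) q) →
    Relation.ReflTransGen (fun a b : Q.points => ChartedHop θ Q a b ∧ dist (b : E3) c ≤ D) x p →
    nn Q x ≤ M₀ * nn Q p

/-- The ball-anywhere chain Harnack implies the clean-ball one (the cleanness hypothesis is simply dropped). -/
theorem cleanBallHarnack_of_chainHarnackIn {θ R M₀ M₁ : ℝ} (h : ChainHarnackIn θ R M₀) : CleanBallHarnack θ R M₀ M₁ :=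
  fun Q x p c D hx hxc hD _ hp => h Q x p c D hx hxc hD hp

/-- … and so does the `x`-centred form at radius `2R`. -/
theorem cleanBallHarnack_of_chainHarnack {θ R M₀ M₁ : ℝ} (h : ChainHarnack θ (2 * R) M₀) : CleanBallHarnack θ R M₀ M₁ :=
  cleanBallHarnack_of_chainHarnackIn (chainHarnackIn_of_chainHarnack h)

/-- `CleanBallHarnack` is monotone: smaller radius, larger `M₀`, larger `M₁` (a stronger cleanness hypothesis) are weaker. -/
theorem cleanBallHarnack_mono {θ R₀ R₁ M₀ M₀' M₁ M₁' : ℝ} (hR : R₁ ≤ R₀) (hM : M₀ ≤ M₀') (hM₁ : M₁ ≤ M₁')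
    (h : CleanBallHarnack θ R₀ M₀ M₁) : CleanBallHarnack θ R₁ M₀' M₁' := by
  intro Q x p c D hx hxc hD hclean hp
  have hX : 0 < nn Q x := Blocks.nearestDist_pt_pos Q x
  have hP : 0 < nn Q p := Blocks.nearestDist_pt_pos Q p
  have h1 := h Q x p c D hx hxc (hD.trans (mul_le_mul_of_nonneg_right hR hX.le))
    (fun q hq hm hqc => hclean q hq
      (hm.trans (mul_le_mul_of_nonneg_right hM₁ (Blocks.nearestDist_pt_pos Q q).le)) hqc) hp
  nlinarith only [h1, hM, hP]

/-- The proved rung transfers: inside the shell ball (`R = 3/5`, ball radius `≤ 3/5·nn x` anywhere) one hop. -/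
theorem cleanBallHarnack_shell {θ M₁ : ℝ} (hθ : θ ≤ 3 / 20) : CleanBallHarnack θ (3 / 5) (4 / 3) M₁ := by
  apply cleanBallHarnack_of_chainHarnack
  rw [show (2 : ℝ) * (3 / 5) = 6 / 5 by norm_num]
  exact chainHarnack_shell hθ

/-! ## §2 The assembly: UPGRADE from clean-ball Harnack and the dictionary -/

section assembly

variable (Q : PeriodicConfiguration 3)

/-- An uncharted charged site `q` at distance `≤ R'·nn x` and of scale `≥ nn x / M` is a comparable gross witness for `x`. -/
theorem nearGrossCmp_of_uncharted_charged {θ R' M : ℝ} {x : Q.motif} {q : Q.points} (hqc : ¬ ChartedAt θ Q q)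
    (hqcharged : ¬ IsChargeFree (1 / 100) (Subtype.val : Q.points → E3) q)
    (hd : dist ((pt Q x : Q.points) : E3) q ≤ R' * nn Q (pt Q x)) (hm : nn Q (pt Q x) ≤ M * nn Q q) :
    NearGrossCmp θ R' M Q (pt Q x) := by
  obtain ⟨y', g', hg', hqeq⟩ := exists_eq_transl_pt Q q
  have hC' : Charged Q y' := by
    intro h; apply hqcharged; rw [hqeq]; exact (Blocks.isChargeFree_transl Q (1 / 100) hg' (pt Q y')).2 h
  have hU' : ¬ ChartedAt θ Q (pt Q y') := fun h => hqc (by rw [hqeq]; exact (chartedAt_transl_iff Q hg' _).2 h)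
  have hqv : (q : E3) = (y' : E3) + g' := by rw [hqeq]; rfl
  have hnnq : nn Q q = nn Q (pt Q y') := by rw [hqeq]; exact Blocks.nearestDist_transl Q hg' (pt Q y')
  exact ⟨y', g', hg', hC', hU', by rw [← hqv]; exact hd, by rw [← hnnq]; exact hm⟩

/-- **UPGRADE ⟸ NOZOOM-CLEAN ∧ DICTIONARY** (`θ ≤ 3/20`):
`CleanBallHarnack θ R M₀ M₁ → ChargeFreeCharted θ → UpgradeWitness θ R (max M₁ (20·M₀)) (2R)`.
Either the core-centred ball contains a comparable uncharted charged site — the witness — or it is clean and part H's extremal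
charted-chain argument applies. -/
theorem upgradeWitness_of_cleanBallHarnack {θ R M₀ M₁ : ℝ} (hθ : θ ≤ 3 / 20) (hM₀ : 0 ≤ M₀)
    (hH : CleanBallHarnack θ R M₀ M₁) (hD : ChargeFreeCharted θ) :
    UpgradeWitness θ R (max M₁ (20 * M₀)) (2 * R) := by
  intro Q x _ hx hn
  obtain ⟨y, g, hg, hC, hU, hd⟩ := hn
  have hcX : 0 < nn Q (pt Q x) := Blocks.nearestDist_pt_pos Q _
  -- the core as a point of `Q`
  obtain ⟨z, hzv, hnnz, hzU⟩ : ∃ z : Q.points, (z : E3) = (y : E3) + g ∧ nn Q z = nn Q (pt Q y) ∧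
      ∀ p : Q.points, ChartedAt θ Q p → z ≠ p :=
    ⟨Blocks.transl Q hg (pt Q y), rfl, Blocks.nearestDist_transl Q hg (pt Q y),
      fun p hp => transl_ne_of_charted Q hU hg hp⟩
  obtain ⟨D₀, hD₀⟩ : ∃ D₀ : ℝ, dist ((pt Q x : Q.points) : E3) (z : E3) = D₀ := ⟨_, rfl⟩
  have hD₀R : D₀ ≤ R * nn Q (pt Q x) := by rw [← hD₀, hzv]; exact hd
  have hRn : 0 ≤ R * nn Q (pt Q x) := dist_nonneg.trans hd
  have h2R : ∀ {q : Q.points}, dist (q : E3) z ≤ D₀ → dist ((pt Q x : Q.points) : E3) q ≤ 2 * R * nn Q (pt Q x) := by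
    intro q hq
    calc dist ((pt Q x : Q.points) : E3) q
          ≤ dist ((pt Q x : Q.points) : E3) z + dist (z : E3) q := dist_triangle _ _ _
      _ ≤ D₀ + D₀ := add_le_add hD₀.le (by rw [dist_comm]; exact hq)
      _ ≤ 2 * R * nn Q (pt Q x) := by linarith
  by_cases hA : ∃ q : Q.points, dist (q : E3) z ≤ D₀ ∧ nn Q (pt Q x) ≤ M₁ * nn Q q ∧ ¬ ChartedAt θ Q q ∧
      ¬ IsChargeFree (1 / 100) (Subtype.val : Q.points → E3) q
  · -- case A: a comparable gross site in the core-centred ball is the witness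
    obtain ⟨q, hqz, hqm, hqc, hqcharged⟩ := hA
    have hq0 : 0 ≤ nn Q q := (Blocks.nearestDist_pt_pos Q q).le
    exact nearGrossCmp_of_uncharted_charged Q hqc hqcharged (h2R hqz)
      (hqm.trans (mul_le_mul_of_nonneg_right (le_max_left _ _) hq0))
  · -- case B: the ball is clean; part H's extremal argument
    push Not at hA
    have hclean : ∀ q : Q.points, dist (q : E3) z ≤ D₀ → nn Q (pt Q x) ≤ M₁ * nn Q q → ¬ ChartedAt θ Q q →
        IsChargeFree (1 / 100) (Subtype.val : Q.points → E3) q :=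
      fun q hq hm hqc => hA q hq hm hqc
    let rel : Q.points → Q.points → Prop := fun a b => ChartedHop θ Q a b ∧ dist (b : E3) z ≤ D₀
    have hfacts : ∀ p : Q.points, Relation.ReflTransGen rel (pt Q x) p → ChartedAt θ Q p ∧ dist (p : E3) z ≤ D₀ := by
      intro p hp
      rcases hp.cases_tail with rfl | ⟨c, -, hcp⟩
      · exact ⟨hx, hD₀.le⟩
      · exact ⟨hcp.1.2.1, hcp.2⟩
    have hharnack : ∀ p : Q.points, Relation.ReflTransGen rel (pt Q x) p → nn Q (pt Q x) ≤ M₀ * nn Q p :=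
      fun p hp => hH Q (pt Q x) p (z : E3) D₀ hx hD₀.le hD₀R hclean hp
    -- finiteness of the reachable set and a closest-to-core reachable site `p`
    have hfin : (Metric.closedBall (z : E3) D₀ ∩ Q.points).Finite := Q.finite_inter_points Metric.isBounded_closedBall
    have hSfin : {p : Q.points | Relation.ReflTransGen rel (pt Q x) p}.Finite := by
      refine (hfin.preimage Subtype.val_injective.injOn).subset fun p hp => ?_
      exact ⟨Metric.mem_closedBall.2 (hfacts p hp).2, p.2⟩
    obtain ⟨p, hpF, hmin⟩ := hSfin.toFinset.exists_min_image (fun p : Q.points => dist (p : E3) z)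
      ⟨pt Q x, hSfin.mem_toFinset.2 Relation.ReflTransGen.refl⟩
    have hpS : Relation.ReflTransGen rel (pt Q x) p := hSfin.mem_toFinset.1 hpF
    obtain ⟨hpc, hpz⟩ := hfacts p hpS
    have hcp : 0 < nn Q p := Blocks.nearestDist_pt_pos Q p
    have hXp := hharnack p hpS
    have h20 : ∀ {s : ℝ}, (1 / 5 - θ) * nn Q p ≤ s → nn Q p ≤ 20 * s := by
      intro s hs
      have h3 : 1 / 20 * nn Q p ≤ (1 / 5 - θ) * nn Q p := mul_le_mul_of_nonneg_right (by linarith) hcp.le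
      linarith
    have hmax : ∀ {s : ℝ}, 0 ≤ s → nn Q p ≤ 20 * s → nn Q (pt Q x) ≤ max M₁ (20 * M₀) * s := by
      intro s hs hps
      calc nn Q (pt Q x) ≤ M₀ * nn Q p := hXp
        _ ≤ M₀ * (20 * s) := mul_le_mul_of_nonneg_left hps hM₀
        _ = 20 * M₀ * s := by ring
        _ ≤ max M₁ (20 * M₀) * s := mul_le_mul_of_nonneg_right (le_max_right _ _) hs
    by_cases hin : dist (p : E3) z ≤ 6 / 5 * nn Q p
    · -- the core lies in `p`'s shell ball: it is the witness
      have hmargin := nn_shell_ge Q (by linarith) hpc (hzU p hpc) hin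
      rw [hnnz] at hmargin
      exact ⟨y, g, hg, hC, hU, hd.trans (by linarith only [hRn]),
        hmax (Blocks.nearestDist_pt_pos Q _).le (h20 hmargin)⟩
    · -- shell exit towards the core
      push Not at hin
      obtain ⟨q, hqp, hqd, hqz⟩ := exists_shell_point_closer Q hθ hpc hin
      by_cases hqc : ChartedAt θ Q q
      · -- a charted exit point is reachable and strictly closer: contradicts minimality
        have hqS : Relation.ReflTransGen rel (pt Q x) q := hpS.tail ⟨⟨hpc, hqc, hqp, hqd⟩, hqz.le.trans hpz⟩
        exact absurd (hmin q (hSfin.mem_toFinset.2 hqS)) (not_le.2 hqz)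
      · -- an uncharted exit point is charged (the dictionary) and is the witness
        have hqcharged : ¬ IsChargeFree (1 / 100) (Subtype.val : Q.points → E3) q := fun h => hqc (hD Q q h)
        have hmargin := nn_shell_ge Q (by linarith) hpc hqp hqd
        exact nearGrossCmp_of_uncharted_charged Q hqc hqcharged (h2R (hqz.le.trans hpz))
          (hmax (Blocks.nearestDist_pt_pos Q q).le (h20 hmargin))

/-- COLLAR from clean-ball Harnack and the dictionary. -/
theorem collarPricing_of_cleanBallHarnack {θ R M₀ M₁ : ℝ} (hθ : θ ≤ 3 / 20) (hR : 0 < R) (hM₀ : 0 ≤ M₀)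
    (hH : CleanBallHarnack θ R M₀ M₁) (hD : ChargeFreeCharted θ) : CollarPricing θ R :=
  collarPricing_of_upgrade (by positivity) ((mul_nonneg (by norm_num) hM₀).trans (le_max_right _ _))
    (upgradeWitness_of_cleanBallHarnack hθ hM₀ hH hD)

/-- **The line beneath P after part I**: `FAR θ R ∧ NOZOOM-CLEAN θ R M₀ M₁ ∧ DICTIONARY θ ⟹ ChartedChargePricing θ`. -/
theorem chartedChargePricing_of_far_cleanBallHarnack {θ R M₀ M₁ : ℝ} (hθ : θ ≤ 3 / 20) (hR : 0 < R) (hM₀ : 0 ≤ M₀)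
    (hF : FarFieldPricing θ R) (hH : CleanBallHarnack θ R M₀ M₁) (hD : ChargeFreeCharted θ) :
    ChartedChargePricing θ :=
  chartedChargePricing_of_far_collar hF (collarPricing_of_cleanBallHarnack hθ hR hM₀ hH hD)

end assembly

end Summit.AtomisticToContinuum.Crystallization.Theorems.ChargedEnergyGapChartDial

end
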